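import Summits.HodgeConjecture.HodgeConjecture.Theorems.RigidRelativesJacobianTorelliHodgeIsoForcesRelativesNonzeroHodgeHomBijective
import Summits.HodgeConjecture.HodgeConjecture.Theorems.RigidRelativesJacobianTorelliRelativesTateOfAnchorOfTransit
import Summits.HodgeConjecture.HodgeConjecture.Theorems.RigidRelativesJacobianTorelliCMCorrespondenceTateOfAnchorOfCMTwist
import Summits.HodgeConjecture.HodgeConjecture.Theorems.Ring2HypothesesDescentMotivatedTraceFormRational
import Literature.AlgebraicGeometry.HodgeTheory.MotivatedClassesRationalSpan
import HarnessLib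

/-!
# Route `RigidRelativesJacobianTorelli` — assembly item `Assembly` (stmt-HodgeConjecture-18583):
# the sector glue by rank-2 linear algebra

`Assembly := HodgeIsoForcesRelatives → HodgeCMForcesGaloisCM → RelativesTate → CMCorrespondenceTate →
SectorComplement → HodgeConjecture`.  The proof obligation is the SECTOR GLUE (the route's `## Assembly`
paragraph): the two transcendence cruxes and the two Tate cruxes give the sector statement
`RigidSectorHodge` (every Hodge homomorphism `Φ : H³((X₀)_ℂ) → H³((X₀')_ℂ)` of rigid-type threefolds over `ℚ`
is an algebraic correspondence), after which `SectorComplement` concludes.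

**The glue** (`rigidSectorHodge_of`).  Write `V = H³((X₀)_ℂ; ℂ) = ℂ x₀ ⊕ ℂ conj x₀` (`x₀` of type `(3,0)`),
likewise `V'`.  If `Φ = 0` it is the zero correspondence.  If `Φ ≠ 0`: `HodgeIsoForcesRelatives` gives
Galois-isomorphy of `X₀, X₀'` (and, inverting the `ℓ`-adic isomorphism, of `X₀', X₀`); `RelativesTate` gives
non-zero algebraic correspondences `Ψ : V → V'`, `Ψ₂ : V' → V`.  Since `algebraicClasses = span_ℂ` of its
RATIONAL members (`algebraicClasses_le_span_isRationalClass`) and `γ ↦ γ_*` is linear, some rational algebraic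
classes `γ₁, γ₂` act non-trivially: `P = γ₁_* : V → V'`, `Q = γ₂_* : V' → V` are algebraic, preserve rational
classes and Hodge types, hence are BIJECTIVE (`bijective_of_isHodgeHom_of_ne_zero`).  On the bases,
`Φ ~ (a, b)`, `P ~ (c, d)`, `Q ~ (c', d')` (diagonal, `c d c' d' ≠ 0`).  If `a d = b c` then `Φ = (a/c) P` is
algebraic.  Otherwise one of `Q ∘ P ~ (c c', d d')`, `Q ∘ Φ ~ (a c', b d')` is a NON-SCALAR rational Hodge
endomorphism of `V`, so `HodgeCMForcesGaloisCM` and `CMCorrespondenceTate` give a non-scalar ALGEBRAIC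
`Θ ~ (α, β)`, `α ≠ β`, and `Φ = s P + t (P ∘ Θ)` with `t = (a/c − b/d)/(α − β)`, `s = a/c − t α` is algebraic
(`IsAlgebraicCorrespondence` is a `ℂ`-subspace closed under composition).  Because the tree's
`IsAlgebraicCorrespondence` allows complex combinations of cycle classes, no `ℚ`-structure argument on
`End_HS(V)` is needed beyond picking rational generators.

No case of the Hodge conjecture is claimed (the four cruxes and the declared complement stay hypotheses of
`closes`).  No definition, no named-fact hypothesis, no sorry.
References: [Deligne1982HodgeCycles] §1–2; [Kleiman1968AlgebraicCycles] §1.3, §3; [VoisinHodgeI2002] §7.1.1,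
Cor. 6.12, Cor. 6.14, §11.1.2; [Andre1996Motifs] §2.1 (p. 14); [GouveaYui2011] §1.
-/

noncomputable section

-- every declaration of this problem lives in `Summit.HodgeConjecture.HodgeConjecture.…` (summit = sub-problem)
set_option linter.dupNamespace false

open CategoryTheory AlgebraicGeometry MonoidalCategory
open Literature.AlgebraicTopology.SingularHomology
open Literature.AlgebraicGeometry.Motives Literature.AlgebraicGeometry.HodgeTheory
open Summit.HodgeConjecture.HodgeConjecture.Ring2.AbelianAll

namespace Summit.HodgeConjecture.HodgeConjecture.Theorems.RigidSector

variable {n : ℕ} {X X' : SchemeOver ℂ}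

/-! ## §1 Rank-2 basis calculus on a rigid-type `Hⁿ = ℂ x₀ ⊕ ℂ conj x₀` -/

/-- **A class of type `(0, n)` is a multiple of `conj x₀`** (`dim Hⁿ = 2`, `x₀ ≠ 0` of type `(n,0)`, `n ≥ 1`):
conjugate, apply the `(n,0)` case, conjugate back. [cite: VoisinHodgeI2002, Cor. 6.12 and Cor. 6.14] -/
theorem exists_eq_smul_conjClass_of_isOfHodgeType_zero_n (hX : IsSmoothProjective n X) (hn : 0 < n)
    (hfin : Module.finrank ℂ (complexBetti X n) = 2) {x₀ : complexBetti X n} (hx₀0 : x₀ ≠ 0)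
    (hx₀ : IsOfHodgeType n X n n 0 x₀) {y : complexBetti X n} (hy : IsOfHodgeType n X n 0 n y) :
    ∃ b : ℂ, y = b • conjClass (ComplexPoints X) n x₀ := by
  obtain ⟨a, ha⟩ :=
    HodgeIsoForcesRelatives.exists_eq_smul_of_isOfHodgeType_n_zero hX hn hfin hx₀0 hx₀ (hy.conjClass hX)
  refine ⟨starRingEnd ℂ a, ?_⟩
  rw [← conjClass_conjClass y, ha, conjClass_smul]

/-- **Two linear maps out of a rigid-type `Hⁿ` agreeing on `x₀` and `conj x₀` are equal** (these two classes
span). [cite: VoisinHodgeI2002, Cor. 6.12 and Cor. 6.14] -/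
theorem linearMap_eq_of_eq_on_pair (hX : IsSmoothProjective n X) (hn : 0 < n)
    (hfin : Module.finrank ℂ (complexBetti X n) = 2) {x₀ : complexBetti X n} (hx₀0 : x₀ ≠ 0)
    (hx₀ : IsOfHodgeType n X n n 0 x₀) {M : Type*} [AddCommGroup M] [Module ℂ M]
    {T₁ T₂ : complexBetti X n →ₗ[ℂ] M} (h₀ : T₁ x₀ = T₂ x₀)
    (h₁ : T₁ (conjClass (ComplexPoints X) n x₀) = T₂ (conjClass (ComplexPoints X) n x₀)) : T₁ = T₂ := by
  refine LinearMap.ext fun x ↦ ?_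
  obtain ⟨c₀, c₁, rfl⟩ := HodgeIsoForcesRelatives.exists_eq_smul_add_smul_conjClass hX hn hfin hx₀0 hx₀ x
  simp only [map_add, map_smul, h₀, h₁]

/-- **A diagonal endomorphism with two different eigenvalues is not a scalar.** [folklore] -/
theorem ne_smul_id_of_eigen {M : Type*} [AddCommGroup M] [Module ℂ M] {x y : M} (hx : x ≠ 0) (hy : y ≠ 0)
    {T : M →ₗ[ℂ] M} {u v : ℂ} (hu : T x = u • x) (hv : T y = v • y) (huv : u ≠ v) (k : ℂ) :
    T ≠ k • LinearMap.id := by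
  intro h
  have h₁ : u • x = k • x := by rw [← hu, h, LinearMap.smul_apply, LinearMap.id_apply]
  have h₂ : v • y = k • y := by rw [← hv, h, LinearMap.smul_apply, LinearMap.id_apply]
  exact huv ((smul_left_injective ℂ hx h₁).trans (smul_left_injective ℂ hy h₂).symm)

/-! ## §2 Rational generators of algebraic correspondences; Hodge types along `γ_*` in the middle degree -/

/-- **A non-zero algebraic correspondence has a non-zero RATIONAL algebraic piece.** If
`T : Hᵃ(X(ℂ)) → Hᵇ(W(ℂ))` is induced by an algebraic class and `T ≠ 0`, then `γ_* ≠ 0` for some RATIONAL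
algebraic class `γ` on `W × X` (complex orientations): `T = γ'_*` with `γ' ∈ Nᵉ = span_ℂ {rational algebraic}`
(`algebraicClasses_le_span_isRationalClass`) and `γ ↦ γ_*` is linear.
[cite: Andre1996Motifs, §2.1 Déf. 1 (p. 14)] [cite: VoisinHodgeI2002, §11.1.2] -/
theorem exists_rational_corrAction_ne_zero {m : ℕ} {W : SchemeOver ℂ} (hW : IsSmoothProjective m W)
    (hX : IsSmoothProjective n X) {a b : ℕ} {T : complexBetti X a →ₗ[ℂ] complexBetti W b}
    (hT : IsAlgebraicCorrespondence m n W X T) (hT0 : T ≠ 0) :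
    ∃ (e : ℕ) (hab : a + 2 * e = b + 2 * n) (γ : complexBetti (W ⊗ X) (2 * e)),
      IsRationalClass γ ∧ γ ∈ algebraicClasses (W ⊗ X) e ∧
        corrAction complexOrientationFamily hW hX hab γ ≠ 0 := by
  obtain ⟨e, hab, γ, hγ, rfl⟩ := IsAlgebraicCorrespondence.exists_eq_corrAction hW hX hT
  by_contra h
  push Not at h
  have key : ∀ δ ∈ Submodule.span ℂ
      {c : complexBetti (W ⊗ X) (2 * e) | IsRationalClass c ∧ c ∈ algebraicClasses (W ⊗ X) e},
      corrAction complexOrientationFamily hW hX hab δ = 0 := by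
    intro δ hδ
    induction hδ using Submodule.span_induction with
    | mem δ hδ => exact h e hab δ hδ.1 hδ.2
    | zero => exact map_zero _
    | add δ δ' _ _ h₁ h₂ => rw [map_add, h₁, h₂, add_zero]
    | smul t δ _ h₁ => rw [map_smul, h₁, smul_zero]
  exact hT0 (key γ (algebraicClasses_le_span_isRationalClass (hW.tensor_holds hX) e hγ))

/-- **`γ_*` preserves every Hodge type `(p, q)` on `Hⁿ` for an algebraic class `γ` on a product of two
`n`-folds** (codimension `e = n` forced by the degrees; `γ` has type `(n, n)`, Voisin I Prop. 11.20, and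
`γ_*` has bidegree `(e − n, e − n) = (0, 0)`). [cite: VoisinHodgeI2002, §7.3.2 and §11.1.2 Prop. 11.20] -/
theorem isOfHodgeType_corrAction_mid {W : SchemeOver ℂ} (hW : IsSmoothProjective n W)
    (hX : IsSmoothProjective n X) {e : ℕ} (hab : n + 2 * e = n + 2 * n) {γ : complexBetti (W ⊗ X) (2 * e)}
    (hγ : γ ∈ algebraicClasses (W ⊗ X) e) {p q : ℕ} {x : complexBetti X n} (hx : IsOfHodgeType n X n p q x) :
    IsOfHodgeType n W n p q (corrAction complexOrientationFamily hW hX hab γ x) := by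
  have he : e = n := by omega
  subst he
  exact RelativesTate.isOfHodgeType_corrAction hW hX hab
    (isOfHodgeType_of_mem_algebraicClasses_of_isSmoothProjective (hW.tensor_holds hX) e hγ) rfl rfl hx

/-! ## §3 The carriers of the route (display only; nothing is defined) -/

/-- `cx Y₀ = Y₀ ⊗_ℚ ℂ` — the route's `let cx`. -/
local notation3 "cx " Y₀:max => (baseChange ℚ ℂ).obj Y₀

/-- `Rigid Y₀` — the route's `let Rigid`. -/
local notation3 "Rigid " Y₀:max => (IsSmoothProjective 3 Y₀ ∧ Module.finrank ℂ (complexBetti (cx Y₀) 3) = 2 ∧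
    ∃ x : complexBetti (cx Y₀) 3, x ≠ 0 ∧ IsOfHodgeType 3 (cx Y₀) 3 3 0 x)

/-- `IsHodgeHom Y Y' Ψ` — the route's `HodgeHom`: rational classes to rational classes, `(p,q)`-classes to
`(p,q)`-classes. -/
local notation3 "IsHodgeHom " Y:max Y':max Ψ:max =>
  ((∀ x, IsRationalClass x → IsRationalClass ((Ψ : complexBetti Y 3 →ₗ[ℂ] complexBetti Y' 3) x)) ∧
    ∀ (p q : ℕ) (x : complexBetti Y 3), IsOfHodgeType 3 Y 3 p q x →
      IsOfHodgeType 3 Y' 3 p q ((Ψ : complexBetti Y 3 →ₗ[ℂ] complexBetti Y' 3) x))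

/-- `GalIso Y₀ Y₀'` — the route's `let GalIso`. -/
local notation3 "GalIso " Y₀:max Y₀':max => (∃ (ℓ : ℕ) (_ : Fact ℓ.Prime) (U : OpenSubgroup (Field.absoluteGaloisGroup ℚ))
    (e : ellAdicEtaleCohomologyRat ℓ 3 (geometricFibre ℚ Y₀) ≃ₗ[ℚ_[ℓ]] ellAdicEtaleCohomologyRat ℓ 3 (geometricFibre ℚ Y₀')),
    ∀ g ∈ U, e.toLinearMap ∘ₗ geometricEllAdicEtaleCohomologyRepRat ℓ Y₀ 3 g =
      geometricEllAdicEtaleCohomologyRepRat ℓ Y₀' 3 g ∘ₗ e.toLinearMap)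

/-- `GalCM Y₀` — the route's `let GalCM`. -/
local notation3 "GalCM " Y₀:max => (∃ (ℓ : ℕ) (_ : Fact ℓ.Prime) (U : OpenSubgroup (Field.absoluteGaloisGroup ℚ))
    (T : ellAdicEtaleCohomologyRat ℓ 3 (geometricFibre ℚ Y₀) →ₗ[ℚ_[ℓ]] ellAdicEtaleCohomologyRat ℓ 3 (geometricFibre ℚ Y₀)),
    (∀ g ∈ U, T ∘ₗ geometricEllAdicEtaleCohomologyRepRat ℓ Y₀ 3 g =
      geometricEllAdicEtaleCohomologyRepRat ℓ Y₀ 3 g ∘ₗ T) ∧ ∀ c : ℚ_[ℓ], T ≠ c • LinearMap.id)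

/-- `RigidSectorHodge` is literally the statement over these carriers. [folklore] -/
theorem rigidSectorHodge_iff :
    Summit.HodgeConjecture.HodgeConjecture.Theses.RigidRelativesJacobianTorelli.RigidSectorHodge ↔
      ∀ ⦃X₀ X₀' : SchemeOver.{0} ℚ⦄, Rigid X₀ → Rigid X₀' →
        ∀ Φ : complexBetti (cx X₀) 3 →ₗ[ℂ] complexBetti (cx X₀') 3,
          IsHodgeHom (cx X₀) (cx X₀') Φ → IsAlgebraicCorrespondence 3 3 (cx X₀') (cx X₀) Φ :=
  Iff.rfl

/-- `HodgeCMForcesGaloisCM` over these carriers. [folklore] -/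
theorem hodgeCMForcesGaloisCM_iff :
    Summit.HodgeConjecture.HodgeConjecture.Theses.RigidRelativesJacobianTorelli.HodgeCMForcesGaloisCM ↔
      ∀ ⦃X₀ : SchemeOver.{0} ℚ⦄, Rigid X₀ →
        ∀ Φ : complexBetti (cx X₀) 3 →ₗ[ℂ] complexBetti (cx X₀) 3,
          IsHodgeHom (cx X₀) (cx X₀) Φ → (∀ c : ℂ, Φ ≠ c • LinearMap.id) → GalCM X₀ :=
  Iff.rfl

/-- **Galois-isomorphy is symmetric** (invert the `ℓ`-adic isomorphism). [folklore] -/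
theorem galIso_symm {X₀ X₀' : SchemeOver.{0} ℚ} (h : GalIso X₀ X₀') : GalIso X₀' X₀ := by
  obtain ⟨ℓ, hℓ, U, e, he⟩ := h
  refine ⟨ℓ, hℓ, U, e.symm, fun g hg ↦ LinearMap.ext fun y ↦ ?_⟩
  have h₁ := LinearMap.congr_fun (he g hg) (e.symm y)
  simp only [LinearMap.coe_comp, Function.comp_apply, LinearEquiv.coe_coe, LinearEquiv.apply_symm_apply] at h₁
  simp only [LinearMap.coe_comp, Function.comp_apply, LinearEquiv.coe_coe]
  rw [← h₁, LinearEquiv.symm_apply_apply]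

/-! ## §4 The sector glue -/

/-- **THE SECTOR GLUE.** The four cruxes of the route give the sector statement `RigidSectorHodge`: every Hodge
homomorphism `H³((X₀)_ℂ) → H³((X₀')_ℂ)` of rigid-type threefolds over `ℚ` is an algebraic correspondence
(rank-2 linear algebra over the real carriers; see the file header).
[cite: Deligne1982HodgeCycles, §1–2] [cite: Kleiman1968AlgebraicCycles, §3] [cite: VoisinHodgeI2002, §7.1.1 and §11.1.2] -/
theorem rigidSectorHodge_of
    (hSep : Summit.HodgeConjecture.HodgeConjecture.Theses.RigidRelativesJacobianTorelli.HodgeIsoForcesRelatives)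
    (hSepCM : Summit.HodgeConjecture.HodgeConjecture.Theses.RigidRelativesJacobianTorelli.HodgeCMForcesGaloisCM)
    (hTate : Summit.HodgeConjecture.HodgeConjecture.Theses.RigidRelativesJacobianTorelli.RelativesTate)
    (hTateCM : Summit.HodgeConjecture.HodgeConjecture.Theses.RigidRelativesJacobianTorelli.CMCorrespondenceTate) :
    Summit.HodgeConjecture.HodgeConjecture.Theses.RigidRelativesJacobianTorelli.RigidSectorHodge := by
  refine rigidSectorHodge_iff.2 fun X₀ X₀' hR hR' Φ hΦ ↦ ?_
  have hX : IsSmoothProjective 3 (cx X₀) := IsSmoothProjective.baseChange_holds (k := ℚ) ℂ hR.1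
  have hX' : IsSmoothProjective 3 (cx X₀') := IsSmoothProjective.baseChange_holds (k := ℚ) ℂ hR'.1
  have h3 : (0 : ℕ) < 3 := by norm_num
  obtain ⟨hfin, x₀, hx₀0, hx₀T⟩ := hR.2
  obtain ⟨hfin', x₀', hx₀'0, hx₀'T⟩ := hR'.2
  have hcx₀0 : conjClass (ComplexPoints (cx X₀)) 3 x₀ ≠ 0 := conjClass_ne_zero hx₀0
  have hcx₀'0 : conjClass (ComplexPoints (cx X₀')) 3 x₀' ≠ 0 := conjClass_ne_zero hx₀'0
  by_cases hΦ0 : Φ = 0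
  · rw [hΦ0]
    exact isAlgebraicCorrespondence_zero hX' hX (e := 3) (by norm_num) (by norm_num)
  -- Galois-isomorphy both ways and non-zero algebraic correspondences both ways
  have hGal : GalIso X₀ X₀' := (HodgeIsoForcesRelatives.hodgeIsoForcesRelatives_iff.1 hSep) hR hR' Φ hΦ hΦ0
  have hGal' : GalIso X₀' X₀ := galIso_symm hGal
  obtain ⟨Ψ, hΨalg, hΨbij⟩ := (RelativesTate.relativesTate_iff.1 hTate) hR hR' hGal
  obtain ⟨Ψ₂, hΨ₂alg, hΨ₂bij⟩ := (RelativesTate.relativesTate_iff.1 hTate) hR' hR hGal'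
  have hΨ0 : Ψ ≠ 0 := fun h ↦ hx₀0 (hΨbij.1 (by rw [map_zero, h, LinearMap.zero_apply]))
  have hΨ₂0 : Ψ₂ ≠ 0 := fun h ↦ hx₀'0 (hΨ₂bij.1 (by rw [map_zero, h, LinearMap.zero_apply]))
  -- rational algebraic generators acting non-trivially: `P : V → V'`, `Q : V' → V`
  obtain ⟨e₁, hab₁, γ₁, hγ₁r, hγ₁a, hP0⟩ := exists_rational_corrAction_ne_zero hX' hX hΨalg hΨ0
  obtain ⟨e₂, hab₂, γ₂, hγ₂r, hγ₂a, hQ0⟩ := exists_rational_corrAction_ne_zero hX hX' hΨ₂alg hΨ₂0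
  set P := corrAction complexOrientationFamily hX' hX hab₁ γ₁ with hPdef
  set Q := corrAction complexOrientationFamily hX hX' hab₂ γ₂ with hQdef
  have hPalg : IsAlgebraicCorrespondence 3 3 (cx X₀') (cx X₀) P :=
    isAlgebraicCorrespondence_corrAction_complex hX' hX hab₁ (by norm_num) hγ₁a
  have hQalg : IsAlgebraicCorrespondence 3 3 (cx X₀) (cx X₀') Q :=
    isAlgebraicCorrespondence_corrAction_complex hX hX' hab₂ (by norm_num) hγ₂a
  have hPrat : ∀ x, IsRationalClass x → IsRationalClass (P x) := fun x hx ↦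
    isRationalClass_corrAction_complexOrientationFamily hX' hX hab₁ hγ₁r hx
  have hQrat : ∀ x, IsRationalClass x → IsRationalClass (Q x) := fun x hx ↦
    isRationalClass_corrAction_complexOrientationFamily hX hX' hab₂ hγ₂r hx
  have hPtyp : ∀ (p q : ℕ) (x : complexBetti (cx X₀) 3), IsOfHodgeType 3 (cx X₀) 3 p q x →
      IsOfHodgeType 3 (cx X₀') 3 p q (P x) := fun p q x hx ↦ isOfHodgeType_corrAction_mid hX' hX hab₁ hγ₁a hx
  have hQtyp : ∀ (p q : ℕ) (x : complexBetti (cx X₀') 3), IsOfHodgeType 3 (cx X₀') 3 p q x →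
      IsOfHodgeType 3 (cx X₀) 3 p q (Q x) := fun p q x hx ↦ isOfHodgeType_corrAction_mid hX hX' hab₂ hγ₂a hx
  have hPbij : Function.Bijective P :=
    HodgeIsoForcesRelatives.bijective_of_isHodgeHom_of_ne_zero hX hX' h3 hfin ⟨x₀, hx₀0, hx₀T⟩ hfin'
      ⟨x₀', hx₀'0, hx₀'T⟩ P hPrat (fun x hx ↦ hPtyp 3 0 x hx) hP0
  have hQbij : Function.Bijective Q :=
    HodgeIsoForcesRelatives.bijective_of_isHodgeHom_of_ne_zero hX' hX h3 hfin' ⟨x₀', hx₀'0, hx₀'T⟩ hfin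
      ⟨x₀, hx₀0, hx₀T⟩ Q hQrat (fun x hx ↦ hQtyp 3 0 x hx) hQ0
  -- matrix coefficients on the bases `(x₀, conj x₀)`, `(x₀', conj x₀')`
  obtain ⟨a, ha⟩ := HodgeIsoForcesRelatives.exists_eq_smul_of_isOfHodgeType_n_zero hX' h3 hfin' hx₀'0 hx₀'T
    (hΦ.2 3 0 x₀ hx₀T)
  obtain ⟨b, hb⟩ := exists_eq_smul_conjClass_of_isOfHodgeType_zero_n hX' h3 hfin' hx₀'0 hx₀'T
    (hΦ.2 0 3 _ (hx₀T.conjClass hX))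
  obtain ⟨c, hc⟩ := HodgeIsoForcesRelatives.exists_eq_smul_of_isOfHodgeType_n_zero hX' h3 hfin' hx₀'0 hx₀'T
    (hPtyp 3 0 x₀ hx₀T)
  obtain ⟨d, hd⟩ := exists_eq_smul_conjClass_of_isOfHodgeType_zero_n hX' h3 hfin' hx₀'0 hx₀'T
    (hPtyp 0 3 _ (hx₀T.conjClass hX))
  obtain ⟨c', hc'⟩ := HodgeIsoForcesRelatives.exists_eq_smul_of_isOfHodgeType_n_zero hX h3 hfin hx₀0 hx₀T
    (hQtyp 3 0 x₀' hx₀'T)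
  obtain ⟨d', hd'⟩ := exists_eq_smul_conjClass_of_isOfHodgeType_zero_n hX h3 hfin hx₀0 hx₀T
    (hQtyp 0 3 _ (hx₀'T.conjClass hX'))
  have hc0 : c ≠ 0 := by
    intro h0
    rw [h0, zero_smul] at hc
    exact hx₀0 (hPbij.1 (by rw [hc, map_zero]))
  have hd0 : d ≠ 0 := by
    intro h0
    rw [h0, zero_smul] at hd
    exact hcx₀0 (hPbij.1 (by rw [hd, map_zero]))
  have hc'0 : c' ≠ 0 := by
    intro h0
    rw [h0, zero_smul] at hc'
    exact hx₀'0 (hQbij.1 (by rw [hc', map_zero]))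
  have hd'0 : d' ≠ 0 := by
    intro h0
    rw [h0, zero_smul] at hd'
    exact hcx₀'0 (hQbij.1 (by rw [hd', map_zero]))
  by_cases had : a * d = b * c
  · -- `Φ = (a/c) P`
    have hΦP : Φ = (a / c) • P := by
      refine linearMap_eq_of_eq_on_pair hX h3 hfin hx₀0 hx₀T ?_ ?_
      · rw [LinearMap.smul_apply, hc, ha, smul_smul, div_mul_cancel₀ a hc0]
      · rw [LinearMap.smul_apply, hd, hb, smul_smul]
        congr 1
        field_simp
        linear_combination -had
    rw [hΦP]
    exact IsAlgebraicCorrespondence.smul hX' hX hPalg _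
  -- the CM case: a non-scalar rational Hodge endomorphism of `V`
  have hN : ∃ N : complexBetti (cx X₀) 3 →ₗ[ℂ] complexBetti (cx X₀) 3,
      IsHodgeHom (cx X₀) (cx X₀) N ∧ ∀ k : ℂ, N ≠ k • LinearMap.id := by
    by_cases hcc : c * c' = d * d'
    · refine ⟨Q ∘ₗ Φ, ⟨fun x hx ↦ hQrat _ (hΦ.1 x hx), fun p q x hx ↦ hQtyp p q _ (hΦ.2 p q x hx)⟩, ?_⟩
      refine ne_smul_id_of_eigen hx₀0 hcx₀0 (u := a * c') (v := b * d') ?_ ?_ ?_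
      · rw [LinearMap.comp_apply, ha, map_smul, hc', smul_smul]
      · rw [LinearMap.comp_apply, hb, map_smul, hd', smul_smul]
      · intro h
        apply had
        refine mul_left_cancel₀ hc'0 ?_
        linear_combination d * h - b * hcc
    · refine ⟨Q ∘ₗ P, ⟨fun x hx ↦ hQrat _ (hPrat x hx), fun p q x hx ↦ hQtyp p q _ (hPtyp p q x hx)⟩, ?_⟩
      refine ne_smul_id_of_eigen hx₀0 hcx₀0 (u := c * c') (v := d * d') ?_ ?_ hcc
      · rw [LinearMap.comp_apply, hc, map_smul, hc', smul_smul]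
      · rw [LinearMap.comp_apply, hd, map_smul, hd', smul_smul]
  obtain ⟨N, hNH, hNns⟩ := hN
  have hCM : GalCM X₀ := (hodgeCMForcesGaloisCM_iff.1 hSepCM) hR N hNH hNns
  obtain ⟨Θ, hΘalg, hΘns⟩ := (CMCorrespondenceTate.cmCorrespondenceTate_iff.1 hTateCM) hR hCM
  -- `Θ ~ (α, β)` with `α ≠ β`
  obtain ⟨e₃, hab₃, γ₃, hγ₃a, hΘeq⟩ := IsAlgebraicCorrespondence.exists_eq_corrAction hX hX hΘalg
  have hΘtyp : ∀ (p q : ℕ) (x : complexBetti (cx X₀) 3), IsOfHodgeType 3 (cx X₀) 3 p q x →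
      IsOfHodgeType 3 (cx X₀) 3 p q (Θ x) := fun p q x hx ↦ by
    rw [hΘeq]
    exact isOfHodgeType_corrAction_mid hX hX hab₃ hγ₃a hx
  obtain ⟨α, hα⟩ := HodgeIsoForcesRelatives.exists_eq_smul_of_isOfHodgeType_n_zero hX h3 hfin hx₀0 hx₀T
    (hΘtyp 3 0 x₀ hx₀T)
  obtain ⟨β, hβ⟩ := exists_eq_smul_conjClass_of_isOfHodgeType_zero_n hX h3 hfin hx₀0 hx₀T
    (hΘtyp 0 3 _ (hx₀T.conjClass hX))
  have hαβ : α ≠ β := by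
    intro h
    apply hΘns α
    refine linearMap_eq_of_eq_on_pair hX h3 hfin hx₀0 hx₀T ?_ ?_
    · rw [hα, LinearMap.smul_apply, LinearMap.id_apply]
    · rw [hβ, ← h, LinearMap.smul_apply, LinearMap.id_apply]
  have hαβ' : α - β ≠ 0 := sub_ne_zero.2 hαβ
  -- `Φ = s P + t (P ∘ Θ)`
  have hΦeq : Φ = (a / c - (a / c - b / d) / (α - β) * α) • P + ((a / c - b / d) / (α - β)) • (P ∘ₗ Θ) := by
    refine linearMap_eq_of_eq_on_pair hX h3 hfin hx₀0 hx₀T ?_ ?_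
    · rw [ha, LinearMap.add_apply, LinearMap.smul_apply, LinearMap.smul_apply, LinearMap.comp_apply, hα,
        map_smul, hc]
      simp only [smul_smul, ← add_smul]
      congr 1
      field_simp
      ring
    · rw [hb, LinearMap.add_apply, LinearMap.smul_apply, LinearMap.smul_apply, LinearMap.comp_apply, hβ,
        map_smul, hd]
      simp only [smul_smul, ← add_smul]
      congr 1
      field_simp
      ring
  rw [hΦeq]
  exact IsAlgebraicCorrespondence.add hX' hX (IsAlgebraicCorrespondence.smul hX' hX hPalg _)
    (IsAlgebraicCorrespondence.smul hX' hX (IsAlgebraicCorrespondence.comp hX' hX hX hΘalg hPalg (by norm_num)) _)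

end Summit.HodgeConjecture.HodgeConjecture.Theorems.RigidSector

namespace Summit.HodgeConjecture.HodgeConjecture.Theorems

/-- **Item stmt-HodgeConjecture-18583 (`Assembly`, route `RigidRelativesJacobianTorelli`)**:
`HodgeIsoForcesRelatives → HodgeCMForcesGaloisCM → RelativesTate → CMCorrespondenceTate → SectorComplement →
HodgeConjecture` — the sector glue `RigidSector.rigidSectorHodge_of` followed by the declared complement.  The
type is literally the route decl `Summit.HodgeConjecture.HodgeConjecture.Theses.RigidRelativesJacobianTorelli.Assembly`.
[cite: Deligne1982HodgeCycles, §1–2] [cite: Kleiman1968AlgebraicCycles, §3] -/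
theorem rigidRelativesJacobianTorelli_assembly_proof :
    Summit.HodgeConjecture.HodgeConjecture.Theses.RigidRelativesJacobianTorelli.Assembly := by
  unfold Summit.HodgeConjecture.HodgeConjecture.Theses.RigidRelativesJacobianTorelli.Assembly
  intro hSep hSepCM hTate hTateCM hC
  exact hC (RigidSector.rigidSectorHodge_of hSep hSepCM hTate hTateCM)

end Summit.HodgeConjecture.HodgeConjecture.Theorems

end
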